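import Mathlib
import Literature.LinearAlgebra.Matrix.GramDeterminantKernel

/-!
# `MatrixDescartes` (stmt-ValiantsHypothesis-18050), line «definite-pair-fold-law» — stub `stub_morse`, part 3:
slices of the pair polynomial and the hyperbolicity of a definite pencil

Bookkeeping for the Morse inequality `stub_morse` of `Cruxes/MatrixDescartes/Lines/definite_pair_fold_law.lean`:

* slices of a bivariate polynomial `Φ : MvPolynomial (Fin 2) ℝ`: the vertical slice
  `MvPolynomial.aeval ![C x, X] Φ ∈ ℝ[X]` (a polynomial in the second variable) and the horizontal slice
  `MvPolynomial.aeval ![X, C t] Φ`; their evaluations are `Φ(x,t)` and their derivatives are the slices of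
  `pderiv 1 Φ`, `pderiv 0 Φ` (`eval_aeval_vslice`, `eval_aeval_hslice`, `derivative_aeval_vslice`,
  `derivative_aeval_hslice`);
* for the line's pair polynomial `Φ = det(Σ_l X₀^{d_l} (P_l − X₁ Q_l))` the vertical slice at `x` is
  `det(A(x) − X·C(x))` with `A(x) = Σ x^{d_l} P_l`, `C(x) = Σ x^{d_l} Q_l`, and the horizontal slice at `t = 1` is
  the pencil determinant `det(Σ_l X^{d_l}(P_l − Q_l))` (`aeval_vslice_pairPoly`, `aeval_hslice_one_pairPoly`);
* HYPERBOLICITY (`pencil_charpoly`): for `A` real symmetric and `C ≻ 0`, `det(A − X·C) = C((−1)^m det C)·χ_M`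
  for the real symmetric `M = R⁻ᴴ A R⁻¹`, `C = RᴴR` (`Literature…exists_eq_conjTranspose_mul_self_of_posSemidef`),
  hence it has degree `m`, leading coefficient `(−1)^m det C` and `m` real roots counted with multiplicity
  (`Matrix.IsHermitian.splits_charpoly`);
* positivity: `A(x), C(x) ≻ 0` for `x > 0` from semidefinite letters with definite sum (`posDef_sum_pow_smul`),
  and then every root of `det(A − t C)` is positive (`pos_of_det_sub_smul_eq_zero`).

Helper mode (`--supports stmt-ValiantsHypothesis-18050`); no definitions.  Honest framing: bookkeeping towards
`stub_morse`; the law `stub_foldLaw`, Conjecture B, the crux `MatrixDescartes` and VP ≠ VNP are OPEN and NOT moved.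
-/

set_option linter.dupNamespace false

namespace Summit.ValiantsHypothesis.ValiantsHypothesis.Theorems.LacunarySymmetroidMatrixDescartes.FoldLaw.Morse

open scoped BigOperators Polynomial Matrix

/-! ### Slices of a bivariate polynomial -/

/-- Evaluation of the vertical slice: `(Φ(x, ·))(t) = Φ(x,t)`. -/
theorem eval_aeval_vslice (Φ : MvPolynomial (Fin 2) ℝ) (x t : ℝ) :
    (MvPolynomial.aeval ![Polynomial.C x, Polynomial.X] Φ).eval t = MvPolynomial.eval ![x, t] Φ := by
  induction Φ using MvPolynomial.induction_on with
  | C a => simp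
  | add p q hp hq => simp [hp, hq]
  | mul_X p i hp => fin_cases i <;> simp [hp]

/-- Evaluation of the horizontal slice: `(Φ(·, t))(x) = Φ(x,t)`. -/
theorem eval_aeval_hslice (Φ : MvPolynomial (Fin 2) ℝ) (x t : ℝ) :
    (MvPolynomial.aeval ![Polynomial.X, Polynomial.C t] Φ).eval x = MvPolynomial.eval ![x, t] Φ := by
  induction Φ using MvPolynomial.induction_on with
  | C a => simp
  | add p q hp hq => simp [hp, hq]
  | mul_X p i hp => fin_cases i <;> simp [hp]

/-- The derivative of the horizontal slice is the horizontal slice of `∂₀Φ`. -/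
theorem derivative_aeval_hslice (Φ : MvPolynomial (Fin 2) ℝ) (t : ℝ) :
    Polynomial.derivative (MvPolynomial.aeval ![Polynomial.X, Polynomial.C t] Φ) =
      MvPolynomial.aeval ![Polynomial.X, Polynomial.C t] (MvPolynomial.pderiv 0 Φ) := by
  induction Φ using MvPolynomial.induction_on with
  | C a => simp
  | add p q hp hq => simp [hp, hq]
  | mul_X p i hp =>
    fin_cases i <;> simp [hp] <;> ring

/-- The derivative of the vertical slice is the vertical slice of `∂₁Φ`. -/
theorem derivative_aeval_vslice (Φ : MvPolynomial (Fin 2) ℝ) (x : ℝ) :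
    Polynomial.derivative (MvPolynomial.aeval ![Polynomial.C x, Polynomial.X] Φ) =
      MvPolynomial.aeval ![Polynomial.C x, Polynomial.X] (MvPolynomial.pderiv 1 Φ) := by
  induction Φ using MvPolynomial.induction_on with
  | C a => simp
  | add p q hp hq => simp [hp, hq]
  | mul_X p i hp =>
    fin_cases i <;> simp [hp] <;> ring

/-- A point of the plane is the pair of its coordinates. -/
theorem vec2_eq (p : Fin 2 → ℝ) : p = ![p 0, p 1] := by
  ext i; fin_cases i <;> rfl

/-! ### Slices of the pair polynomial of the line -/

section Pencil

variable {m K : ℕ} (d : Fin K → ℕ) (P Q : Fin K → Matrix (Fin m) (Fin m) ℝ)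

/-- Vertical slice of the pair polynomial: `Φ(x, ·) = det(A(x) − X·C(x))`. -/
theorem aeval_vslice_pairPoly (x : ℝ) :
    MvPolynomial.aeval ![Polynomial.C x, Polynomial.X]
        (∑ l, (MvPolynomial.X (0 : Fin 2) : MvPolynomial (Fin 2) ℝ) ^ d l •
          ((P l).map (MvPolynomial.C : ℝ →+* MvPolynomial (Fin 2) ℝ)
            - (MvPolynomial.X (1 : Fin 2) : MvPolynomial (Fin 2) ℝ) •
              (Q l).map (MvPolynomial.C : ℝ →+* MvPolynomial (Fin 2) ℝ))).det =
      ((∑ l, x ^ d l • P l).map Polynomial.C -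
        (Polynomial.X : ℝ[X]) • (∑ l, x ^ d l • Q l).map Polynomial.C).det := by
  rw [AlgHom.map_det]
  congr 1
  refine Matrix.ext fun i j => ?_
  simp [Matrix.sum_apply, Finset.sum_sub_distrib, Finset.mul_sum, mul_sub]
  exact Finset.sum_congr rfl fun l _ => by ring

/-- Horizontal slice at `t = 1`: `Φ(·, 1)` is the pencil determinant of `P − Q`. -/
theorem aeval_hslice_one_pairPoly :
    MvPolynomial.aeval ![Polynomial.X, Polynomial.C (1:ℝ)]
        (∑ l, (MvPolynomial.X (0 : Fin 2) : MvPolynomial (Fin 2) ℝ) ^ d l •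
          ((P l).map (MvPolynomial.C : ℝ →+* MvPolynomial (Fin 2) ℝ)
            - (MvPolynomial.X (1 : Fin 2) : MvPolynomial (Fin 2) ℝ) •
              (Q l).map (MvPolynomial.C : ℝ →+* MvPolynomial (Fin 2) ℝ))).det =
      (∑ l, (Polynomial.X : ℝ[X]) ^ d l • (P l - Q l).map Polynomial.C).det := by
  rw [AlgHom.map_det]
  congr 1
  refine Matrix.ext fun i j => ?_
  simp [Matrix.sum_apply, mul_sub]

end Pencil

/-! ### Hyperbolicity of a definite pencil -/

/-- **`det(A − X·C)` for `A` real symmetric and `C ≻ 0`** has degree `m`, leading coefficient `(−1)^m det C`,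
and `m` real roots counted with multiplicity.  (Write `C = RᴴR`; then
`A − X·C = Rᴴ (M − X·1) R` with `M = R⁻ᴴ A R⁻¹` symmetric, whose characteristic polynomial splits over `ℝ`.) -/
theorem pencil_charpoly {m : ℕ} {A Cm : Matrix (Fin m) (Fin m) ℝ} (hA : A.IsHermitian) (hC : Cm.PosDef) :
    (A.map Polynomial.C - (Polynomial.X : ℝ[X]) • Cm.map Polynomial.C).det.natDegree = m ∧
    (A.map Polynomial.C - (Polynomial.X : ℝ[X]) • Cm.map Polynomial.C).det.leadingCoeff =
      (-1) ^ m * Cm.det ∧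
    Multiset.card (A.map Polynomial.C - (Polynomial.X : ℝ[X]) • Cm.map Polynomial.C).det.roots = m := by
  classical
  obtain ⟨R, hR⟩ :=
    Literature.LinearAlgebra.Matrix.exists_eq_conjTranspose_mul_self_of_posSemidef hC.posSemidef
  have hdetC : Cm.det = R.det * R.det := by
    rw [hR, Matrix.det_mul, Matrix.det_conjTranspose, star_trivial]
  have hdetCpos : 0 < Cm.det := hC.det_pos
  have hRdet : R.det ≠ 0 := fun h => by
    rw [hdetC, h, mul_zero] at hdetCpos; exact lt_irrefl _ hdetCpos
  have hRunit : IsUnit R.det := isUnit_iff_ne_zero.2 hRdet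
  set S := R⁻¹ with hS
  have hSR : S * R = 1 := Matrix.nonsing_inv_mul R hRunit
  set M := Sᴴ * A * S with hM
  have hMh : M.IsHermitian := Matrix.isHermitian_conjTranspose_mul_mul S hA
  have hAM : A = Rᴴ * M * R := by
    calc A = (S * R)ᴴ * A * (S * R) := by
          rw [hSR, Matrix.conjTranspose_one, Matrix.one_mul, Matrix.mul_one]
      _ = Rᴴ * (Sᴴ * A * S) * R := by
          rw [Matrix.conjTranspose_mul]; simp only [Matrix.mul_assoc]
  have hfac : Rᴴ.map Polynomial.C * (M.map Polynomial.C - (Polynomial.X : ℝ[X]) • 1) * R.map Polynomial.C =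
      A.map Polynomial.C - (Polynomial.X : ℝ[X]) • Cm.map Polynomial.C := by
    rw [Matrix.mul_sub, Matrix.sub_mul, Matrix.mul_smul, Matrix.smul_mul, Matrix.mul_one,
      ← Matrix.map_mul, ← Matrix.map_mul, ← Matrix.map_mul, ← hAM, ← hR]
  have hmid : (M.map Polynomial.C - (Polynomial.X : ℝ[X]) • (1 : Matrix (Fin m) (Fin m) ℝ[X])).det =
      (-1) ^ m * M.charpoly := by
    have : M.map Polynomial.C - (Polynomial.X : ℝ[X]) • (1 : Matrix (Fin m) (Fin m) ℝ[X]) =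
        -(Matrix.charmatrix M) := by
      rw [Matrix.charmatrix, RingHom.mapMatrix_apply, Matrix.smul_one_eq_diagonal, ← Matrix.scalar_apply,
        neg_sub]
    rw [this, Matrix.det_neg, Matrix.charpoly, Fintype.card_fin]
  have hdR : (R.map Polynomial.C).det = Polynomial.C R.det := by
    rw [← RingHom.mapMatrix_apply, ← RingHom.map_det]
  have hdRh : (Rᴴ.map Polynomial.C).det = Polynomial.C R.det := by
    rw [← RingHom.mapMatrix_apply, ← RingHom.map_det, Matrix.det_conjTranspose, star_trivial]
  have hψ : (A.map Polynomial.C - (Polynomial.X : ℝ[X]) • Cm.map Polynomial.C).det =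
      Polynomial.C ((-1) ^ m * Cm.det) * M.charpoly := by
    rw [← hfac, Matrix.det_mul, Matrix.det_mul, hmid, hdRh, hdR, hdetC, map_mul, map_mul, map_pow,
      map_neg, map_one]
    ring
  have ha : ((-1 : ℝ) ^ m * Cm.det) ≠ 0 := mul_ne_zero (pow_ne_zero _ (by norm_num)) hdetCpos.ne'
  refine ⟨?_, ?_, ?_⟩
  · rw [hψ, Polynomial.natDegree_C_mul ha, Matrix.charpoly_natDegree_eq_dim, Fintype.card_fin]
  · rw [hψ, Polynomial.leadingCoeff_mul, Polynomial.leadingCoeff_C, (Matrix.charpoly_monic M).leadingCoeff,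
      mul_one]
  · rw [hψ, Polynomial.roots_C_mul _ ha, Polynomial.splits_iff_card_roots.1 hMh.splits_charpoly,
      Matrix.charpoly_natDegree_eq_dim, Fintype.card_fin]

/-- Evaluation of `det(A − X·C)` at `t` is `det(A − t C)`. -/
theorem eval_det_sub_smul {m : ℕ} (A Cm : Matrix (Fin m) (Fin m) ℝ) (t : ℝ) :
    (A.map Polynomial.C - (Polynomial.X : ℝ[X]) • Cm.map Polynomial.C).det.eval t = (A - t • Cm).det := by
  rw [← Polynomial.coe_evalRingHom, RingHom.map_det]
  congr 1
  refine Matrix.ext fun i j => ?_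
  simp [Matrix.sub_apply, Matrix.smul_apply, Matrix.map_apply]
  ring

/-! ### Positivity -/

/-- `Σ_l x^{d_l} Q_l ≻ 0` for `x > 0` when the `Q_l` are positive semidefinite with positive definite sum. -/
theorem posDef_sum_pow_smul {m K : ℕ} (d : Fin K → ℕ) (Q : Fin K → Matrix (Fin m) (Fin m) ℝ)
    (hQ : ∀ l, (Q l).PosSemidef) (hsum : (∑ l, Q l).PosDef) {x : ℝ} (hx : 0 < x) :
    (∑ l, x ^ d l • Q l).PosDef := by
  set μ := (min x 1) ^ (∑ l, d l) with hμ
  have hmin : 0 < min x 1 := lt_min hx one_pos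
  have hμ0 : 0 < μ := pow_pos hmin _
  have hμle : ∀ l, μ ≤ x ^ d l := by
    intro l
    calc μ = (min x 1) ^ (∑ l, d l) := rfl
      _ ≤ (min x 1) ^ d l := pow_le_pow_of_le_one hmin.le (min_le_right _ _)
          (Finset.single_le_sum (fun _ _ => Nat.zero_le _) (Finset.mem_univ l))
      _ ≤ x ^ d l := pow_le_pow_left₀ hmin.le (min_le_left _ _) _
  have hdecomp : ∑ l, x ^ d l • Q l = μ • ∑ l, Q l + ∑ l, (x ^ d l - μ) • Q l := by
    rw [Finset.smul_sum, ← Finset.sum_add_distrib]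
    refine Finset.sum_congr rfl fun l _ => ?_
    rw [← add_smul]
    congr 1
    ring
  rw [hdecomp]
  exact (hsum.smul hμ0).add_posSemidef
    (Matrix.posSemidef_sum Finset.univ fun l _ => (hQ l).smul (sub_nonneg.2 (hμle l)))

/-- For `A ≻ 0` and `C ⪰ 0`, every root `t` of `det(A − t C)` is positive. -/
theorem pos_of_det_sub_smul_eq_zero {m : ℕ} {A Cm : Matrix (Fin m) (Fin m) ℝ} (hA : A.PosDef)
    (hC : Cm.PosSemidef) {t : ℝ} (ht : (A - t • Cm).det = 0) : 0 < t := by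
  by_contra hle
  have hle' : 0 ≤ -t := by linarith [not_lt.1 hle]
  have hpd : (A - t • Cm).PosDef := by
    have : A - t • Cm = A + (-t) • Cm := by rw [neg_smul, sub_eq_add_neg]
    rw [this]
    exact hA.add_posSemidef (hC.smul hle')
  exact absurd ht hpd.det_pos.ne'

end Summit.ValiantsHypothesis.ValiantsHypothesis.Theorems.LacunarySymmetroidMatrixDescartes.FoldLaw.Morse
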